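import Summits.RiemannHypothesis.RiemannHypothesis.Theorems.SoloInformedRigidityProbe
import Literature.NumberTheory.LFunctions.WeilArchModulatedGrowth
import Literature.NumberTheory.LFunctions.WeilArchimedeanPositivityProofs
import Literature.NumberTheory.LFunctions.WeilArchimedeanMoments
import HarnessLib

/-!
# Pair-correlation rigidity, step R2c: the archimedean term of the probe (T72g, soloist)

Sorry-free.  For the probe `f_{b,t}(x) = Φ_b(x) e^{-itx}` (`Φ_b = weilDilate (b⁻¹ - 1) Φ`,
`SoloInformedRigidityProbe`) and `k = f ⋆ f̃`, the archimedean term of the explicit formula is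
`W_∞(k) = (1/2π) ∫ |f̂(1/2 + iτ)|² Re ψ(1/4 + iτ/2) dτ - ‖Φ‖₂² log π`.  We prove the
**`b`-uniform** bound

  `|Re W_∞(k)| ≤ ‖Φ‖₂² (log (3 + |t|) + 12 + log π) + (1/2π) ∫ |Φ̂(1/2 + iv)|² log (1 + |v|) dv`

for all `b ≥ 1` and all real `t` (`abs_re_weilArchTerm_probe_le`): after the change of variables
`v = b (τ - t)` the integral is `∫ |Φ̂(1/2 + iv)|² Re ψ(1/4 + i(v/b + t)/2) dv`
(`re_weilArchIntegral_probe`), the crude digamma bound `|Re ψ(1/4 + iτ/2)| ≤ log (3 + |τ|) + 12`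
and `log (3 + |v/b + t|) ≤ log (3 + |t|) + log (1 + |v|)` (`b ≥ 1`) give the claim, with
`∫ |Φ̂(1/2 + iv)|² dv = 2π ‖Φ‖₂²` (Plancherel on the critical line).  This is the arch part of
(U) in Lemma 2k.E of the soloist's `paper/sharpest.md` §2k (xi): on a window at height `h` the
archimedean contribution to `Z(t) = Re Q(f_{b,t})` is `log h + O_Φ(1)`, uniformly in the
bandwidth `b`.
-/

noncomputable section

open Real Complex MeasureTheory Set Filter Literature.NumberTheory.LFunctions

namespace Summit.RiemannHypothesis.RiemannHypothesis.Theorems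

/-- `v ↦ |Φ̂(1/2 + iv)|² L(v)` is integrable for a continuous weight of linear growth. -/
theorem integrable_norm_sq_weilMellin_half_mul {Φ : ℝ → ℂ} (hΦ : IsWeilTest Φ) {L : ℝ → ℝ}
    (hL : Continuous L) {C : ℝ} (hC : ∀ u, |L u| ≤ C * (1 + |u|)) :
    Integrable fun v : ℝ ↦ ‖weilMellin Φ (1 / 2 + v * I)‖ ^ 2 * L v := by
  have h := (integrable_weilMellin_half_mul_of_linear (hΦ.weilConv hΦ.weilReflect) hL hC).re
  refine h.congr (Eventually.of_forall fun v ↦ ?_)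
  simp only [RCLike.re_to_complex]
  rw [weilMellin_weilConv_weilReflect_half hΦ, ← Complex.ofReal_mul, Complex.ofReal_re]

/-- The shifted digamma weight: for `b ≥ 1`,
`|Re ψ(1/4 + i(v/b + t)/2)| ≤ log (3 + |t|) + 12 + log (1 + |v|)`. -/
theorem abs_re_digamma_shift_le {b : ℝ} (hb : 1 ≤ b) (t v : ℝ) :
    |(Complex.digamma (1 / 4 + ((v / b + t : ℝ) : ℂ) / 2 * I)).re| ≤
      Real.log (3 + |t|) + 12 + Real.log (1 + |v|) := by
  have h1 := abs_re_digamma_quarter_le_log (v / b + t)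
  have hvb : |v / b| ≤ |v| := by
    rw [abs_div, abs_of_pos (by linarith : (0 : ℝ) < b)]
    exact div_le_self (abs_nonneg v) hb
  have h2 : Real.log (3 + |v / b + t|) ≤ Real.log (3 + |t|) + Real.log (1 + |v|) := by
    rw [← Real.log_mul (by positivity) (by positivity)]
    refine Real.log_le_log (by positivity) ?_
    nlinarith [abs_add_le (v / b) t, abs_nonneg t, abs_nonneg (v / b), abs_nonneg v]
  linarith

/-- **Change of variables** `v = b(τ - t)`: the archimedean integral of `k = f ⋆ f̃` is
`∫ |Φ̂(1/2 + iv)|² Re ψ(1/4 + i(v/b + t)/2) dv`. -/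
theorem re_weilArchIntegral_probe {Φ : ℝ → ℂ} (hΦ : IsWeilTest Φ) {b : ℝ} (hb : 0 < b) (t : ℝ) :
    (weilArchIntegral (weilConv (fun x ↦ weilDilate (b⁻¹ - 1) Φ x * cexp (((-t) * x : ℝ) * I))
        (weilReflect fun x ↦ weilDilate (b⁻¹ - 1) Φ x * cexp (((-t) * x : ℝ) * I)))).re =
      ∫ v : ℝ, ‖weilMellin Φ (1 / 2 + v * I)‖ ^ 2 *
        (Complex.digamma (1 / 4 + ((v / b + t : ℝ) : ℂ) / 2 * I)).re := by
  have hb0 : b ≠ 0 := hb.ne'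
  obtain ⟨G, hG⟩ : ∃ G : ℝ → ℝ, G = fun v : ℝ ↦ ‖weilMellin Φ (1 / 2 + v * I)‖ ^ 2 *
      (Complex.digamma (1 / 4 + ((v / b + t : ℝ) : ℂ) / 2 * I)).re := ⟨_, rfl⟩
  rw [weilArchIntegral_weilConv_weilReflect (isWeilTest_probe hΦ hb t), Complex.ofReal_re]
  have h2 : (∫ τ : ℝ, ‖weilMellin (fun x ↦ weilDilate (b⁻¹ - 1) Φ x * cexp (((-t) * x : ℝ) * I))
      (1 / 2 + τ * I)‖ ^ 2 * (Complex.digamma (1 / 4 + τ / 2 * I)).re) =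
      ∫ τ : ℝ, (fun y : ℝ ↦ b * G (b * y)) (τ - t) :=
    integral_congr_ae (Eventually.of_forall fun τ ↦ by
      simp only [hG, norm_sq_weilMellin_probe_half Φ hb t]
      have : ((b * (τ - t) / b + t : ℝ) : ℂ) = (τ : ℂ) := by
        rw [mul_div_cancel_left₀ _ hb0, sub_add_cancel]
      rw [this]
      ring)
  rw [h2, integral_sub_right_eq_self (fun y : ℝ ↦ b * G (b * y)) t, integral_const_mul,
    Measure.integral_comp_mul_left G b, smul_eq_mul, abs_of_pos (inv_pos.2 hb), ← mul_assoc,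
    mul_inv_cancel₀ hb0, one_mul, hG]

/-- **The archimedean integral of the probe, `b`-uniformly**: for `b ≥ 1` and all real `t`,
`|∫ |f̂(1/2 + iτ)|² Re ψ(1/4 + iτ/2) dτ| ≤ (log (3 + |t|) + 12) · 2π ‖Φ‖₂²
  + ∫ |Φ̂(1/2 + iv)|² log (1 + |v|) dv`. -/
theorem abs_re_weilArchIntegral_probe_le {Φ : ℝ → ℂ} (hΦ : IsWeilTest Φ) {b : ℝ} (hb : 1 ≤ b)
    (t : ℝ) :
    |(weilArchIntegral (weilConv (fun x ↦ weilDilate (b⁻¹ - 1) Φ x * cexp (((-t) * x : ℝ) * I))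
        (weilReflect fun x ↦ weilDilate (b⁻¹ - 1) Φ x * cexp (((-t) * x : ℝ) * I)))).re| ≤
      (Real.log (3 + |t|) + 12) * (2 * π * ∫ x : ℝ, ‖Φ x‖ ^ 2) +
        ∫ v : ℝ, ‖weilMellin Φ (1 / 2 + v * I)‖ ^ 2 * Real.log (1 + |v|) := by
  have hb0 : 0 < b := by linarith
  rw [re_weilArchIntegral_probe hΦ hb0 t]
  obtain ⟨L, hL⟩ : ∃ L : ℝ, L = Real.log (3 + |t|) + 12 := ⟨_, rfl⟩
  have hL0 : 0 ≤ L := by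
    rw [hL]
    have := Real.log_nonneg (by linarith [abs_nonneg t] : (1 : ℝ) ≤ 3 + |t|)
    linarith
  have hlog1 : ∀ v : ℝ, Real.log (1 + |v|) ≤ |v| := fun v ↦ by
    have := Real.log_le_sub_one_of_pos (by positivity : (0 : ℝ) < 1 + |v|)
    linarith
  have hlog0 : ∀ v : ℝ, 0 ≤ Real.log (1 + |v|) := fun v ↦
    Real.log_nonneg (by linarith [abs_nonneg v])
  -- integrability of the three weights
  have hIψ : Integrable fun v : ℝ ↦ ‖weilMellin Φ (1 / 2 + v * I)‖ ^ 2 *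
      (Complex.digamma (1 / 4 + ((v / b + t : ℝ) : ℂ) / 2 * I)).re := by
    refine integrable_norm_sq_weilMellin_half_mul hΦ
      (L := fun v ↦ (Complex.digamma (1 / 4 + ((v / b + t : ℝ) : ℂ) / 2 * I)).re)
      (continuous_re_digamma_quarter_half.comp ((continuous_id.div_const b).add
        continuous_const)) (C := L + 1) fun v ↦ ?_
    have h := abs_re_digamma_shift_le hb t v
    rw [← hL] at h
    nlinarith [hlog1 v, abs_nonneg v]
  have hIlog : Integrable fun v : ℝ ↦ ‖weilMellin Φ (1 / 2 + v * I)‖ ^ 2 *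
      Real.log (1 + |v|) :=
    integrable_norm_sq_weilMellin_half_mul hΦ (L := fun v ↦ Real.log (1 + |v|))
      ((continuous_const.add continuous_abs).log fun v ↦
        (by have := abs_nonneg v; positivity : (1 : ℝ) + |v| ≠ 0)) (C := 1) fun v ↦ by
        rw [abs_of_nonneg (hlog0 v)]; nlinarith [hlog1 v, abs_nonneg v]
  have hI1 : Integrable fun v : ℝ ↦ ‖weilMellin Φ (1 / 2 + v * I)‖ ^ 2 := by
    have h := integrable_norm_sq_weilMellin_half_mul hΦ (L := fun _ ↦ (1 : ℝ))
      continuous_const (C := 1) fun v ↦ by rw [abs_one]; linarith [abs_nonneg v]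
    simpa using h
  have hIL : Integrable fun v : ℝ ↦ ‖weilMellin Φ (1 / 2 + v * I)‖ ^ 2 *
      (L + Real.log (1 + |v|)) := by
    have h := (hI1.const_mul L).add hIlog
    refine h.congr (Eventually.of_forall fun v ↦ ?_)
    simp only [Pi.add_apply]
    ring
  calc |∫ v : ℝ, ‖weilMellin Φ (1 / 2 + v * I)‖ ^ 2 *
          (Complex.digamma (1 / 4 + ((v / b + t : ℝ) : ℂ) / 2 * I)).re|
      ≤ ∫ v : ℝ, |‖weilMellin Φ (1 / 2 + v * I)‖ ^ 2 *
          (Complex.digamma (1 / 4 + ((v / b + t : ℝ) : ℂ) / 2 * I)).re| :=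
        abs_integral_le_integral_abs
    _ ≤ ∫ v : ℝ, ‖weilMellin Φ (1 / 2 + v * I)‖ ^ 2 * (L + Real.log (1 + |v|)) := by
        refine integral_mono hIψ.abs hIL fun v ↦ ?_
        dsimp only
        rw [abs_mul, abs_of_nonneg (by positivity : (0 : ℝ) ≤ ‖weilMellin Φ (1 / 2 + v * I)‖ ^ 2)]
        refine mul_le_mul_of_nonneg_left ?_ (by positivity)
        have h := abs_re_digamma_shift_le hb t v
        rw [← hL] at h
        exact h
    _ = L * (∫ v : ℝ, ‖weilMellin Φ (1 / 2 + v * I)‖ ^ 2) +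
          ∫ v : ℝ, ‖weilMellin Φ (1 / 2 + v * I)‖ ^ 2 * Real.log (1 + |v|) := by
        rw [← integral_const_mul, ← integral_add (hI1.const_mul L) hIlog]
        exact integral_congr_ae (Eventually.of_forall fun v ↦ by ring)
    _ = _ := by rw [integral_norm_sq_weilMellin_half_line hΦ, weilNorm2Sq, hL]

/-- **Archimedean term of the probe, `b`-uniformly** (step R2c of Lemma 2k.E): for `b ≥ 1` and
all real `t`,
`|Re W_∞(f ⋆ f̃)| ≤ ‖Φ‖₂² (log (3 + |t|) + 12 + log π) + (1/2π) ∫ |Φ̂(1/2 + iv)|² log (1 + |v|) dv`.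
-/
theorem abs_re_weilArchTerm_probe_le {Φ : ℝ → ℂ} (hΦ : IsWeilTest Φ) {b : ℝ} (hb : 1 ≤ b)
    (t : ℝ) :
    |(weilArchTerm (weilConv (fun x ↦ weilDilate (b⁻¹ - 1) Φ x * cexp (((-t) * x : ℝ) * I))
        (weilReflect fun x ↦ weilDilate (b⁻¹ - 1) Φ x * cexp (((-t) * x : ℝ) * I)))).re| ≤
      (∫ x : ℝ, ‖Φ x‖ ^ 2) * (Real.log (3 + |t|) + 12 + Real.log π) +
        1 / (2 * π) * ∫ v : ℝ, ‖weilMellin Φ (1 / 2 + v * I)‖ ^ 2 * Real.log (1 + |v|) := by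
  have hb0 : 0 < b := by linarith
  have hk0 : weilConv (fun x ↦ weilDilate (b⁻¹ - 1) Φ x * cexp (((-t) * x : ℝ) * I))
      (weilReflect fun x ↦ weilDilate (b⁻¹ - 1) Φ x * cexp (((-t) * x : ℝ) * I)) 0 =
      ((∫ x : ℝ, ‖Φ x‖ ^ 2 : ℝ) : ℂ) := by
    rw [weilConv_weilReflect_apply_zero, integral_norm_sq_probe Φ hb0 t]
  have hc : (1 / (2 * π) : ℂ) = ((1 / (2 * π) : ℝ) : ℂ) := by push_cast; ring
  have hre : (weilArchTerm (weilConv (fun x ↦ weilDilate (b⁻¹ - 1) Φ x *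
      cexp (((-t) * x : ℝ) * I)) (weilReflect fun x ↦ weilDilate (b⁻¹ - 1) Φ x *
      cexp (((-t) * x : ℝ) * I)))).re = 1 / (2 * π) * (weilArchIntegral (weilConv
      (fun x ↦ weilDilate (b⁻¹ - 1) Φ x * cexp (((-t) * x : ℝ) * I)) (weilReflect fun x ↦
      weilDilate (b⁻¹ - 1) Φ x * cexp (((-t) * x : ℝ) * I)))).re -
      (∫ x : ℝ, ‖Φ x‖ ^ 2) * Real.log π := by
    rw [weilArchTerm, hk0, hc, Complex.sub_re, Complex.re_ofReal_mul, ← Complex.ofReal_mul,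
      Complex.ofReal_re]
  rw [hre]
  have hA := abs_re_weilArchIntegral_probe_le hΦ hb t
  have hπ : 0 < π := Real.pi_pos
  have hlogπ : 0 ≤ Real.log π := Real.log_nonneg (by linarith [Real.pi_gt_three])
  have hE : 0 ≤ ∫ x : ℝ, ‖Φ x‖ ^ 2 := integral_nonneg fun _ ↦ by positivity
  generalize (∫ v : ℝ, ‖weilMellin Φ (1 / 2 + v * I)‖ ^ 2 * Real.log (1 + |v|)) = J at hA ⊢
  generalize (∫ x : ℝ, ‖Φ x‖ ^ 2) = E at hA hE ⊢
  generalize (weilArchIntegral (weilConv (fun x ↦ weilDilate (b⁻¹ - 1) Φ x *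
    cexp (((-t) * x : ℝ) * I)) (weilReflect fun x ↦ weilDilate (b⁻¹ - 1) Φ x *
    cexp (((-t) * x : ℝ) * I)))).re = X at hA ⊢
  calc |1 / (2 * π) * X - E * Real.log π|
      ≤ |1 / (2 * π) * X| + |E * Real.log π| := abs_sub _ _
    _ = 1 / (2 * π) * |X| + E * Real.log π := by
        rw [abs_mul, abs_of_pos (by positivity : (0 : ℝ) < 1 / (2 * π)),
          abs_of_nonneg (mul_nonneg hE hlogπ)]
    _ ≤ 1 / (2 * π) * ((Real.log (3 + |t|) + 12) * (2 * π * E) + J) + E * Real.log π := by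
        gcongr
    _ = _ := by
        field_simp
        ring

end Summit.RiemannHypothesis.RiemannHypothesis.Theorems

end
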